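import Summits.BirchSwinnertonDyer.BirchSwinnertonDyer.Theorems.EdixhovenFibreFiveSevenStarredOptimalManinUnitFiveSevenAssembly
import Summits.BirchSwinnertonDyer.BirchSwinnertonDyer.Theorems.AdditiveKolyvaginRoadManinFrameResidueProperRTameTwistLegendre
import Summits.BirchSwinnertonDyer.BirchSwinnertonDyer.Theorems.AdditiveKolyvaginRoadManinFrameResidueProperRTameTwistSymbols
import Summits.BirchSwinnertonDyer.BirchSwinnertonDyer.Theorems.AdditiveKolyvaginRoadManinFrameResidueProperRTameTwistSymbols57
import Summits.BirchSwinnertonDyer.BirchSwinnertonDyer.Theorems.AdditiveKolyvaginRoadManinFrameResidueProperRTameTwistSplitL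
import Summits.BirchSwinnertonDyer.BirchSwinnertonDyer.Theorems.AdditiveKolyvaginRoadManinFrameResidueProperRTameTwistSplit4
import Literature.NumberTheory.EllipticCurves.ModularCurveRealPeriodProofs
import Literature.NumberTheory.EllipticCurves.ModularCurveManinSemistableBridgeProofs
import Literature.NumberTheory.EllipticCurves.ComplexMultiplicationBurungaleFlachProofs
import Literature.NumberTheory.EllipticCurves.ModularFormsGamma0Genus
import Literature.NumberTheory.EllipticCurves.ModularSymbols
import Literature.NumberTheory.EllipticCurves.Isogeny
import Literature.NumberTheory.EllipticCurves.ModularCurve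
import Literature.NumberTheory.EllipticCurves.ModularCurveNeronLatticeProofs
import Literature.NumberTheory.EllipticCurves.KatoAdditiveTwistedValueNeronIntegrality
import Literature.NumberTheory.EllipticCurves.BSDQuadraticDescentArchimedeanProofs
import Literature.NumberTheory.EllipticCurves.ImaginaryPeriod
import Literature.NumberTheory.EllipticCurves.RealLatticePeriodDiscrProofs
import Literature.NumberTheory.EllipticCurves.EichlerShimuraConstructionLatticeProofs
import Literature.NumberTheory.EllipticCurves.NeronIsogenyScalingHoldsProofs
import Literature.NumberTheory.EllipticCurves.SkinnerUrban2014.PAdicUnitPeriodRatioAnyPrimeProofs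
import Literature.NumberTheory.EllipticCurves.SkinnerUrban2014.PAdicUnitImaginaryPeriodRatioProofs
import Literature.NumberTheory.EllipticCurves.CuspFormLFunctionLevelConductorProofs
import Literature.NumberTheory.EllipticCurves.NonEisensteinPrimeOfSurjective
import Literature.NumberTheory.EllipticCurves.KrausOesterle1992.TorsionCongruenceCriterionHasseWeilProofs
import Literature.NumberTheory.EllipticCurves.ModularDegreeQuadraticTwistProofs
import Literature.NumberTheory.EllipticCurves.KatzPrimePowerEisensteinTorsionProofs
import Literature.NumberTheory.EllipticCurves.EisensteinCongruenceRationalTorsionProofs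
import Literature.NumberTheory.EllipticCurves.BSDWave0
import Literature.NumberTheory.EllipticCurves.VariableChangePoints
import Literature.NumberTheory.EllipticCurves.GlobalMinimalModelProofs
import Literature.NumberTheory.EllipticCurves.IsogenyVariableChangeProofs
import Literature.NumberTheory.EllipticCurves.IsogenyCompProofs
import Literature.NumberTheory.EllipticCurves.CyclicIsogenyCharacterFrobeniusProofs
import Literature.NumberTheory.EllipticCurves.StableCyclicSubgroupTransportProofs
import Literature.NumberTheory.EllipticCurves.DivisionFieldRamificationDividesProofs
import Literature.NumberTheory.EllipticCurves.DeligneSerreWeightOneIrreducibleKroneckerWeberProofs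
import Literature.NumberTheory.EllipticCurves.GaloisActionProofs
import Literature.NumberTheory.EllipticCurves.LFunctionPrimeCoeff
import Literature.NumberTheory.GaloisRepresentations.KroneckerWeberTheorem
import Literature.NumberTheory.GaloisRepresentations.ModNCyclotomicCharacter
import Literature.NumberTheory.GaloisRepresentations.FramedRepTwistEulerFactorProofs
import Literature.NumberTheory.GaloisRepresentations.IntegralGaloisActionProofs
import Literature.NumberTheory.GaloisRepresentations.DirichletCharacterOfGaloisCharacter
import Literature.NumberTheory.EllipticCurves.OpenImageMazurTwistProofs
import Literature.NumberTheory.EllipticCurves.RootNumberTwistProofs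
import Literature.NumberTheory.EllipticCurves.HidaFamilyMembersProofs
import Literature.NumberTheory.EllipticCurves.OpenImageMazurCharacterProofs


/-!
# Two-parity member lever — the EXACT KERNEL PARITY LAW (bsd-idea-19 g14, lens dual)

Supplement to `Cruxes/ManinPrimeToAdditiveFiveLe/two_parity_member_sketch.lean` rev 8 (crux idea
`two-parity-member-lever` on stmt-BirchSwinnertonDyer-22969, bearing on stmt-BirchSwinnertonDyer-25138
`TwistFamilyManinDescent.EisensteinAdditiveManinResidual` = R).  Self-contained (the sketch is not an importable
module); nothing here grows the sketch.  BSD is not proved; R is not proved.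

## What is new

The sketch's P-2 `CyclicKernelPeriodDichotomy` is SIGN-BLIND: for a `p`-primitive integral isogeny scalar
`αΛ(E₀) ⊆ Λ(W_K)` it says that in at least ONE parity `s ∈ {+,−}` the period ratio `Ω^s(E₀)/Ω^s(W_K)` is a rational
number of `p`-valuation `≤ 0`, and the assembly therefore needs BOTH member levers (odd: wall-free; even: behind the
non-resonance wall `EvenNonResonant`, Mazur's torsion theorem, (E0-T) and (E1)).

This file proves the EXACT law deciding WHICH parity it is.  Let `M := {z ∈ Λ(W_K) | ∃ n, pⁿz ∈ αΛ(E₀)}` be the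
`p`-saturation of `αΛ(E₀)` in `Λ(W_K)`; `M/αΛ(E₀)` is the `p`-part of the kernel of the isogeny `z ↦ αz`, a finite
cyclic `p`-group on which complex conjugation acts by a sign `ε ∈ {±1}` (`p` odd).

* `imaginaryRatio_of_evenKernelAt`: `ε = +1` (conjugation fixes `M/αΛ`) ⇒ the IMAGINARY ratio
  `Ω⁻(E₀)/Ω⁻(W_K)` is rational of valuation `−v_p(α) ≤ 0`;
* `realRatio_of_oddKernelAt`: `ε = −1` ⇒ the REAL ratio `Ω⁺(E₀)/Ω⁺(W_K)` is rational of valuation `≤ 0`.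

Proof (even case): `α·iΩ₀⁻ = b·iΩ₀⁻'`; if `p ∣ b`, `z := (b/p)·iΩ₀⁻' ∈ Λ(W_K)` has `pz = α·iΩ₀⁻ ∈ αΛ(E₀)`, so `z ∈ M`
and `z̄ − z = −2z ∈ αΛ(E₀)`, i.e. `(2b/p)Ω₀⁻'/α ∈ ℤΩ₀⁻`, i.e. `2 = −jp` — impossible for `p` odd.  No primitivity is
needed for the law itself (only `α ≠ 0`).

## What it buys (the half-assembly `residualEvenSign_of_katoMemberOddParity`, PROVED)

On every row of R whose optimal curve has EVEN KERNEL SIGN (`EvenKernelSign`: conjugation fixes the `p`-part of the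
kernel of every `p`-primitive integral scalar to every globally minimal member) the ODD member lever ALONE gives
`p ∤ c(D)`: no `EvenNonResonant` wall, no Mazur torsion input, no (E0-T)/(E1).  Dually
(`residualOddSign_of_katoMemberEvenParity`) the odd-sign rows are exactly the ones that consume the even lever.

DICTIONARY (memo `Lines/two-parity-kernel-parity.md`, not a kernel statement): every integral scalar between
Néron lattices of `ℚ`-curves is a `ℚ`-isogeny, its cyclic `p`-kernel carries a character `χ : G_ℚ → (ℤ/p^k)ˣ`, and
`ε = χ(conj)`; when `E₀[p]` is reducible NON-SPLIT with stable line `φ₁`, `χ ≡ φ₁ (mod p)` forces `ε = φ₁(−1)` for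
every member — so `EvenKernelSign(E₀, p) ⟸ φ₁ even`.  Calibration: the g10 desk audit
(`Lines/two-parity-member-audit.md`) found `Λ(W_K) ⊋ Λ(E₀)` of index `p` exactly in the census parity `c = τ₋₁` on
10/10 K15a rows — `c` IS `ε`, and the law predicts equality (up to `p`-units) in parity `−ε`, as observed
(225e1, 400c1, 450b1, 441d1, 784h1: `ε = +1`, odd lever only; 50a1, 75a1, 325d1, 49a1, 1225b1: `ε = −1`, even lever);
11a1 → 11a2 = 11a1/(ℤ/5) (`ε = +1`): `Ω⁺(11a2) = Ω⁺(11a1)/5`, `Ω⁻` equal; 11a1 → 11a3 = 11a1/μ₅ (`ε = −1`, `α = 5`):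
`Ω⁺(11a1) = Ω⁺(11a3)/5` (`q = 1/5`, `v₅(q) = −1 ≤ 0`), as the law says.
-/

set_option autoImplicit false
set_option linter.dupNamespace false

noncomputable section

open scoped MatrixGroups ModularForm Classical NumberField TensorProduct
open CongruenceSubgroup WeierstrassCurve IsDedekindDomain NumberField
open Literature.NumberTheory.GaloisRepresentations
open Literature.NumberTheory.EllipticCurves Literature.NumberTheory.EllipticCurves.ModularForms
open Literature.NumberTheory.EllipticCurves.Kato2004 Literature.NumberTheory.EllipticCurves.Kato2004.EulerSystemValues
open Literature.NumberTheory.EllipticCurves.Rank1Residual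
open Summit.BirchSwinnertonDyer.BirchSwinnertonDyer.Theorems
open Summit.BirchSwinnertonDyer.BirchSwinnertonDyer.Theorems.SemiLocalDescent
open Summit.BirchSwinnertonDyer.BirchSwinnertonDyer.Theorems.KatoNeronIsogenyTransport
open Summit.BirchSwinnertonDyer.BirchSwinnertonDyer.Theorems.KatoAssemblySocket
open Summit.BirchSwinnertonDyer.BirchSwinnertonDyer.Theorems.StarredOptimalManinUnitFiveSevenValueExit

namespace Summit.BirchSwinnertonDyer.BirchSwinnertonDyer.Cruxes.ManinPrimeToAdditiveFiveLe.TwoParityKernelParity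

/-! ## §0  Kernel signs -/

/-- **Even kernel sign** of the scalar `α : Λ → Λ'` at `p`: complex conjugation FIXES the `p`-saturation
`M = {z ∈ Λ' | ∃ n, pⁿ z ∈ αΛ}` modulo `αΛ` (`z̄ − z ∈ αΛ` for `z ∈ M`). -/
def EvenKernelAt (L L' : PeriodPair) (p : ℕ) (α : ℤ) : Prop :=
  ∀ z ∈ L'.lattice, (∃ n : ℕ, ∃ w ∈ L.lattice, (p : ℂ) ^ n * z = (α : ℂ) * w) →
    ∃ w ∈ L.lattice, starRingEnd ℂ z - z = (α : ℂ) * w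

/-- **Odd kernel sign**: complex conjugation acts by `−1` on `M/αΛ` (`z̄ + z ∈ αΛ` for `z ∈ M`). -/
def OddKernelAt (L L' : PeriodPair) (p : ℕ) (α : ℤ) : Prop :=
  ∀ z ∈ L'.lattice, (∃ n : ℕ, ∃ w ∈ L.lattice, (p : ℂ) ^ n * z = (α : ℂ) * w) →
    ∃ w ∈ L.lattice, starRingEnd ℂ z + z = (α : ℂ) * w

/-- Both signs at once force the `p`-part of the kernel to be trivial: `M = αΛ` (for `z ∈ M`, `2z ∈ αΛ` and
`pⁿz ∈ αΛ` with `gcd(2, pⁿ) = 1`).  Conversely a scalar with `M = αΛ` has both signs (trivially). -/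
theorem saturated_of_even_of_odd {L L' : PeriodPair} {p : ℕ} (hp : Odd p) {α : ℤ}
    (he : EvenKernelAt L L' p α) (ho : OddKernelAt L L' p α) :
    ∀ z ∈ L'.lattice, (∃ n : ℕ, ∃ w ∈ L.lattice, (p : ℂ) ^ n * z = (α : ℂ) * w) →
      ∃ w ∈ L.lattice, z = (α : ℂ) * w := by
  intro z hz hsat
  obtain ⟨w₁, hw₁, h₁⟩ := he z hz hsat
  obtain ⟨w₂, hw₂, h₂⟩ := ho z hz hsat
  obtain ⟨n, w, hw, hn⟩ := hsat
  -- `2z = α(w₂ - w₁)` and `pⁿ z = α w`; `pⁿ` odd: `pⁿ = 2t + 1`, so `z = pⁿz - t·2z`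
  obtain ⟨t, ht⟩ := hp.pow (n := n)
  refine ⟨w - t • (w₂ - w₁), sub_mem hw (nsmul_mem (sub_mem hw₂ hw₁) t), ?_⟩
  have h2 : (2 : ℂ) * z = (α : ℂ) * (w₂ - w₁) := by linear_combination h₂ - h₁
  have hpn : ((p : ℂ)) ^ n = 2 * (t : ℂ) + 1 := by exact_mod_cast ht
  rw [nsmul_eq_mul]
  linear_combination hn - (t : ℂ) * h2 - z * hpn

/-! ## §1  Lattice helpers (the sketch's §3 helpers, re-homed so this file stands alone) -/

section Helpers

open Complex

/-- `g₂` of a Néron lattice of `W ⊗ ℂ` is the real number `c₄(W ⊗ ℝ)/12`. -/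
theorem g₂_eq_ofReal_of_isNeronLatticeOf {W : WeierstrassCurve ℚ} {L : PeriodPair}
    (hL : IsNeronLatticeOf (W.baseChange ℂ) L) :
    L.g₂ = (((W.baseChange ℝ).c₄ / 12 : ℝ) : ℂ) := by
  rw [hL.1, WeierstrassCurve.baseChange, WeierstrassCurve.baseChange, WeierstrassCurve.map_c₄,
    WeierstrassCurve.map_c₄, eq_ratCast, eq_ratCast]
  push_cast
  ring

/-- `g₃` of a Néron lattice of `W ⊗ ℂ` is the real number `c₆(W ⊗ ℝ)/216`. -/
theorem g₃_eq_ofReal_of_isNeronLatticeOf {W : WeierstrassCurve ℚ} {L : PeriodPair}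
    (hL : IsNeronLatticeOf (W.baseChange ℂ) L) :
    L.g₃ = (((W.baseChange ℝ).c₆ / 216 : ℝ) : ℂ) := by
  rw [hL.2, WeierstrassCurve.baseChange, WeierstrassCurve.baseChange, WeierstrassCurve.map_c₆,
    WeierstrassCurve.map_c₆, eq_ratCast, eq_ratCast]
  push_cast
  ring

/-- `i·Ω₀(iΛ) ∈ Λ`: the least positive real period of the rotated lattice gives an imaginary period. -/
theorem I_mul_minRealPeriod_mulLeft_I_mem {L : PeriodPair} (h : L.IsReal) :
    I * ((L.mulLeft I I_ne_zero).minRealPeriod : ℂ) ∈ L.lattice := by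
  have := h.mulLeft_I.minRealPeriod_mem_lattice
  rwa [PeriodPair.mem_mulLeft_lattice, Complex.inv_I, neg_mul, neg_mem_iff] at this

/-- `#π₀(E(ℝ)) ∈ {1, 2}`. -/
theorem numRealComponents_eq_one_or_two (V : WeierstrassCurve ℝ) :
    V.numRealComponents = 1 ∨ V.numRealComponents = 2 := by
  rcases lt_or_ge 0 V.Δ with h | h
  · exact Or.inr (V.numRealComponents_of_Δ_pos h)
  · exact Or.inl (V.numRealComponents_of_Δ_nonpos h)

/-- `v_p(u/v) ≤ 0` for integers `u, v` with `p ∤ u`, `v ≠ 0`. -/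
theorem padicValRat_intCast_div_le_zero {p : ℕ} [Fact p.Prime] {u v : ℤ} (hu : ¬ (p : ℤ) ∣ u)
    (hv : v ≠ 0) : padicValRat p ((u : ℚ) / v) ≤ 0 := by
  have hu0 : u ≠ 0 := by rintro rfl; exact hu (dvd_zero _)
  rw [padicValRat.div (by exact_mod_cast hu0) (by exact_mod_cast hv), padicValRat.of_int,
    padicValRat.of_int, padicValInt.eq_zero_of_not_dvd hu]
  simp

/-- `p ∣ 2` is impossible for a prime `p ≠ 2` — the one arithmetic fact behind the parity law. -/
theorem not_two_add_mul_eq_zero {p : ℕ} [Fact p.Prime] (hp2 : p ≠ 2) (j : ℤ) : (2 : ℤ) + j * p ≠ 0 := by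
  intro h
  have hpP : p.Prime := Fact.out
  have h5 : (p : ℤ) ∣ 2 := ⟨-j, by linear_combination h⟩
  have h6 : p ∣ 2 := by exact_mod_cast h5
  exact hp2 ((Nat.prime_dvd_prime_iff_eq hpP Nat.prime_two).mp h6)

end Helpers

/-! ## §2  The exact parity law -/

section ParityLaw

open Complex

/-- ★ **Even kernel ⇒ the IMAGINARY period ratio is `p`-co-integral.**  If `αΛ(W) ⊆ Λ(W')` (`α ∈ ℤ ∖ 0`, `p` odd)
and complex conjugation fixes the `p`-saturation of `αΛ(W)` in `Λ(W')` modulo `αΛ(W)`, then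
`Ω⁻(W) = q·Ω⁻(W')` with `q ∈ ℚˣ`, `v_p(q) ≤ 0` (indeed `q = b/α` with `p ∤ b`). -/
theorem imaginaryRatio_of_evenKernelAt (W W' : WeierstrassCurve ℚ) [W.IsElliptic] [W.IsGloballyMinimal]
    [W'.IsElliptic] [W'.IsGloballyMinimal] (L L' : PeriodPair) (p : ℕ) [Fact p.Prime] (α : ℤ)
    (hL : IsNeronLatticeOf (W.baseChange ℂ) L) (hL' : IsNeronLatticeOf (W'.baseChange ℂ) L') (hp2 : p ≠ 2)
    (hα0 : α ≠ 0) (hαL : ∀ z ∈ L.lattice, (α : ℂ) * z ∈ L'.lattice) (hsign : EvenKernelAt L L' p α) :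
    ∃ q : ℚ, q ≠ 0 ∧ padicValRat p q ≤ 0 ∧ (q : ℝ) * W'.imaginaryPeriodRat = W.imaginaryPeriodRat := by
  -- real structures of the two Néron lattices
  have h₂ := g₂_eq_ofReal_of_isNeronLatticeOf hL
  have h₃ := g₃_eq_ofReal_of_isNeronLatticeOf hL
  have h₂' := g₂_eq_ofReal_of_isNeronLatticeOf hL'
  have h₃' := g₃_eq_ofReal_of_isNeronLatticeOf hL'
  have hR : L.IsReal := (W.baseChange ℝ).isReal_of_g₂_eq_of_g₃_eq h₂ h₃
  have hR' : L'.IsReal := (W'.baseChange ℝ).isReal_of_g₂_eq_of_g₃_eq h₂' h₃'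
  haveI : (W.baseChange ℝ).IsElliptic := by rw [WeierstrassCurve.baseChange]; infer_instance
  haveI : (W'.baseChange ℝ).IsElliptic := by rw [WeierstrassCurve.baseChange]; infer_instance
  -- imaginary generators `iΩ₀⁻ ∈ Λ`, `iΩ₀⁻' ∈ Λ'`
  set v : ℝ := (L.mulLeft I I_ne_zero).minRealPeriod with hvdef
  set v' : ℝ := (L'.mulLeft I I_ne_zero).minRealPeriod with hv'def
  have hIv : I * (v : ℂ) ∈ L.lattice := I_mul_minRealPeriod_mulLeft_I_mem hR
  have hIv' : I * (v' : ℂ) ∈ L'.lattice := I_mul_minRealPeriod_mulLeft_I_mem hR'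
  have hvpos : 0 < v := hR.mulLeft_I.minRealPeriod_pos
  have hv'pos : 0 < v' := hR'.mulLeft_I.minRealPeriod_pos
  have hΩv : W.imaginaryPeriodRat = v := by
    rw [WeierstrassCurve.imaginaryPeriodRat_def]
    exact (W.baseChange ℝ).imaginaryPeriod_eq h₂ h₃
  have hΩv' : W'.imaginaryPeriodRat = v' := by
    rw [WeierstrassCurve.imaginaryPeriodRat_def]
    exact (W'.baseChange ℝ).imaginaryPeriod_eq h₂' h₃'
  have hαR : (α : ℝ) ≠ 0 := by exact_mod_cast hα0
  have hαC : (α : ℂ) ≠ 0 := by exact_mod_cast hα0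
  -- `α·iΩ₀⁻ = b·iΩ₀⁻'` with `b ∈ ℤ`
  have hαv : (((α : ℝ) * v : ℝ) : ℂ) ∈ (L'.mulLeft I I_ne_zero).lattice := by
    rw [PeriodPair.mem_mulLeft_lattice, Complex.inv_I, neg_mul, neg_mem_iff]
    have e : I * (((α : ℝ) * v : ℝ) : ℂ) = (α : ℂ) * (I * (v : ℂ)) := by push_cast; ring
    rw [e]
    exact hαL _ hIv
  obtain ⟨b, hb⟩ := hR'.mulLeft_I.exists_eq_int_mul hαv
  -- THE SIGN ARGUMENT: `p ∤ b`
  have hpb : ¬ (p : ℤ) ∣ b := by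
    rintro ⟨b', hb'⟩
    have hb'0 : b' ≠ 0 := by
      rintro rfl
      rw [mul_zero] at hb'
      rw [hb', Int.cast_zero, zero_mul] at hb
      rcases mul_eq_zero.mp hb with h | h
      · exact hαR h
      · exact hvpos.ne' h
    have hb'R : (b' : ℝ) ≠ 0 := by exact_mod_cast hb'0
    have hbR : (b : ℝ) = (p : ℝ) * (b' : ℝ) := by exact_mod_cast hb'
    have hbC : (α : ℂ) * (v : ℂ) = (p : ℂ) * (b' : ℂ) * (v' : ℂ) := by
      have := congrArg (fun x : ℝ ↦ (x : ℂ)) hb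
      push_cast at this
      rw [this]
      have := congrArg (fun x : ℝ ↦ (x : ℂ)) hbR
      push_cast at this
      rw [this]
    -- `z := b'·iΩ₀⁻' ∈ Λ'` lies in the `p`-saturation: `p z = α·iΩ₀⁻`
    have hz : (b' : ℂ) * (I * (v' : ℂ)) ∈ L'.lattice := by
      have := zsmul_mem hIv' b'
      rwa [zsmul_eq_mul] at this
    have hsat : ∃ n : ℕ, ∃ w ∈ L.lattice, (p : ℂ) ^ n * ((b' : ℂ) * (I * (v' : ℂ))) = (α : ℂ) * w := by
      refine ⟨1, _, hIv, ?_⟩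
      rw [pow_one]
      linear_combination (-I) * hbC
    obtain ⟨w, hw, hcw⟩ := hsign _ hz hsat
    -- `z̄ − z = −2z`
    have hconj : starRingEnd ℂ ((b' : ℂ) * (I * (v' : ℂ))) - (b' : ℂ) * (I * (v' : ℂ)) =
        -2 * ((b' : ℂ) * (I * (v' : ℂ))) := by
      simp only [map_mul, Complex.conj_I, Complex.conj_ofReal, map_intCast]
      ring
    rw [hconj] at hcw
    -- so `w = i·x` with `x = −2b'Ω₀⁻'/α` real, and `x ∈ ℤΩ₀⁻`
    have hwx : w = I * (((-2 * b' * v' / α : ℝ)) : ℂ) := by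
      apply mul_left_cancel₀ hαC
      rw [← hcw]
      push_cast
      field_simp
    have hx : (((-2 * b' * v' / α : ℝ)) : ℂ) ∈ (L.mulLeft I I_ne_zero).lattice := by
      rw [PeriodPair.mem_mulLeft_lattice, Complex.inv_I, neg_mul, neg_mem_iff, ← hwx]
      exact hw
    obtain ⟨j, hj⟩ := hR.mulLeft_I.exists_eq_int_mul hx
    rw [div_eq_iff hαR] at hj
    -- `−2b'Ω₀⁻' = j·αΩ₀⁻ = j·b·Ω₀⁻' = j·p·b'·Ω₀⁻'`, so `2 + jp = 0`
    have h2 : ((2 : ℝ) + j * p) * ((b' : ℝ) * v') = 0 := by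
      linear_combination (-1 : ℝ) * hj - (j : ℝ) * hb - (j : ℝ) * v' * hbR
    have h3 : (2 : ℝ) + j * p = 0 := by
      rcases mul_eq_zero.mp h2 with h | h
      · exact h
      · exact absurd h (mul_ne_zero hb'R hv'pos.ne')
    have h4 : (2 : ℤ) + j * p = 0 := by exact_mod_cast h3
    exact not_two_add_mul_eq_zero hp2 j h4
  have hb0 : b ≠ 0 := by
    rintro rfl
    exact hpb (dvd_zero _)
  refine ⟨((b : ℤ) : ℚ) / ((α : ℤ) : ℚ), ?_, ?_, ?_⟩
  · exact div_ne_zero (by exact_mod_cast hb0) (by exact_mod_cast hα0)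
  · exact padicValRat_intCast_div_le_zero hpb hα0
  · rw [hΩv, hΩv']
    push_cast
    field_simp
    linear_combination -hb

/-- ★ **Odd kernel ⇒ the REAL period ratio is `p`-co-integral.**  If `αΛ(W) ⊆ Λ(W')` (`α ∈ ℤ ∖ 0`, `p` odd) and
complex conjugation acts by `−1` on the `p`-saturation of `αΛ(W)` in `Λ(W')` modulo `αΛ(W)`, then
`Ω⁺(W) = q·Ω⁺(W')` with `q ∈ ℚˣ`, `v_p(q) ≤ 0` (`q = n a/(n' α)`, `p ∤ a`, `n, n' ∈ {1,2}` the component counts). -/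
theorem realRatio_of_oddKernelAt (W W' : WeierstrassCurve ℚ) [W.IsElliptic] [W.IsGloballyMinimal]
    [W'.IsElliptic] [W'.IsGloballyMinimal] (L L' : PeriodPair) (p : ℕ) [Fact p.Prime] (α : ℤ)
    (hL : IsNeronLatticeOf (W.baseChange ℂ) L) (hL' : IsNeronLatticeOf (W'.baseChange ℂ) L') (hp2 : p ≠ 2)
    (hα0 : α ≠ 0) (hαL : ∀ z ∈ L.lattice, (α : ℂ) * z ∈ L'.lattice) (hsign : OddKernelAt L L' p α) :
    ∃ q : ℚ, q ≠ 0 ∧ padicValRat p q ≤ 0 ∧ (q : ℝ) * W'.realPeriodRat = W.realPeriodRat := by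
  have hpP : p.Prime := Fact.out
  have hpZ : Prime (p : ℤ) := Nat.prime_iff_prime_int.mp hpP
  have h₂ := g₂_eq_ofReal_of_isNeronLatticeOf hL
  have h₃ := g₃_eq_ofReal_of_isNeronLatticeOf hL
  have h₂' := g₂_eq_ofReal_of_isNeronLatticeOf hL'
  have h₃' := g₃_eq_ofReal_of_isNeronLatticeOf hL'
  have hR : L.IsReal := (W.baseChange ℝ).isReal_of_g₂_eq_of_g₃_eq h₂ h₃
  have hR' : L'.IsReal := (W'.baseChange ℝ).isReal_of_g₂_eq_of_g₃_eq h₂' h₃'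
  haveI : (W.baseChange ℝ).IsElliptic := by rw [WeierstrassCurve.baseChange]; infer_instance
  haveI : (W'.baseChange ℝ).IsElliptic := by rw [WeierstrassCurve.baseChange]; infer_instance
  -- real generators `Ω₀ ∈ Λ`, `Ω₀' ∈ Λ'`
  set u : ℝ := L.minRealPeriod with hudef
  set u' : ℝ := L'.minRealPeriod with hu'def
  have hu : (u : ℂ) ∈ L.lattice := hR.minRealPeriod_mem_lattice
  have hu' : (u' : ℂ) ∈ L'.lattice := hR'.minRealPeriod_mem_lattice
  have hupos : 0 < u := hR.minRealPeriod_pos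
  have hu'pos : 0 < u' := hR'.minRealPeriod_pos
  have hΩ : W.realPeriodRat = (W.baseChange ℝ).numRealComponents * u := by
    rw [WeierstrassCurve.realPeriodRat_def]
    exact (W.baseChange ℝ).realPeriod_eq_numRealComponents_mul_minRealPeriod h₂ h₃
  have hΩ' : W'.realPeriodRat = (W'.baseChange ℝ).numRealComponents * u' := by
    rw [WeierstrassCurve.realPeriodRat_def]
    exact (W'.baseChange ℝ).realPeriod_eq_numRealComponents_mul_minRealPeriod h₂' h₃'
  have hαR : (α : ℝ) ≠ 0 := by exact_mod_cast hα0
  have hαC : (α : ℂ) ≠ 0 := by exact_mod_cast hα0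
  -- `αΩ₀ = aΩ₀'` with `a ∈ ℤ`
  have hαu : (((α : ℝ) * u : ℝ) : ℂ) ∈ L'.lattice := by
    push_cast
    exact hαL _ hu
  obtain ⟨a, ha⟩ := hR'.exists_eq_int_mul hαu
  -- THE SIGN ARGUMENT: `p ∤ a`
  have hpa : ¬ (p : ℤ) ∣ a := by
    rintro ⟨a', ha'⟩
    have ha'0 : a' ≠ 0 := by
      rintro rfl
      rw [mul_zero] at ha'
      rw [ha', Int.cast_zero, zero_mul] at ha
      rcases mul_eq_zero.mp ha with h | h
      · exact hαR h
      · exact hupos.ne' h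
    have ha'R : (a' : ℝ) ≠ 0 := by exact_mod_cast ha'0
    have haR : (a : ℝ) = (p : ℝ) * (a' : ℝ) := by exact_mod_cast ha'
    have haC : (α : ℂ) * (u : ℂ) = (p : ℂ) * (a' : ℂ) * (u' : ℂ) := by
      have := congrArg (fun x : ℝ ↦ (x : ℂ)) ha
      push_cast at this
      rw [this]
      have := congrArg (fun x : ℝ ↦ (x : ℂ)) haR
      push_cast at this
      rw [this]
    -- `z := a'Ω₀' ∈ Λ'` lies in the `p`-saturation: `p z = αΩ₀`
    have hz : (a' : ℂ) * (u' : ℂ) ∈ L'.lattice := by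
      have := zsmul_mem hu' a'
      rwa [zsmul_eq_mul] at this
    have hsat : ∃ n : ℕ, ∃ w ∈ L.lattice, (p : ℂ) ^ n * ((a' : ℂ) * (u' : ℂ)) = (α : ℂ) * w := by
      refine ⟨1, _, hu, ?_⟩
      rw [pow_one]
      linear_combination (-1 : ℂ) * haC
    obtain ⟨w, hw, hcw⟩ := hsign _ hz hsat
    -- `z̄ + z = 2z`
    have hconj : starRingEnd ℂ ((a' : ℂ) * (u' : ℂ)) + (a' : ℂ) * (u' : ℂ) = 2 * ((a' : ℂ) * (u' : ℂ)) := by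
      simp only [map_mul, Complex.conj_ofReal, map_intCast]
      ring
    rw [hconj] at hcw
    -- so `w = x` with `x = 2a'Ω₀'/α` real, and `x ∈ ℤΩ₀`
    have hwx : w = (((2 * a' * u' / α : ℝ)) : ℂ) := by
      apply mul_left_cancel₀ hαC
      rw [← hcw]
      push_cast
      field_simp
    have hx : (((2 * a' * u' / α : ℝ)) : ℂ) ∈ L.lattice := hwx ▸ hw
    obtain ⟨j, hj⟩ := hR.exists_eq_int_mul hx
    rw [div_eq_iff hαR] at hj
    -- `2a'Ω₀' = j·αΩ₀ = j·a·Ω₀' = j·p·a'·Ω₀'`, so `2 − jp = 0`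
    have h2 : ((2 : ℝ) + (-j) * p) * ((a' : ℝ) * u') = 0 := by
      linear_combination hj + (j : ℝ) * ha + (j : ℝ) * u' * haR
    have h3 : (2 : ℝ) + (-j) * p = 0 := by
      rcases mul_eq_zero.mp h2 with h | h
      · exact h
      · exact absurd h (mul_ne_zero ha'R hu'pos.ne')
    have h4 : (2 : ℤ) + (-j) * p = 0 := by exact_mod_cast h3
    exact not_two_add_mul_eq_zero hp2 (-j) h4
  have ha0 : a ≠ 0 := by
    rintro rfl
    exact hpa (dvd_zero _)
  -- component counts
  obtain ⟨n, hn⟩ : ∃ n : ℕ, (W.baseChange ℝ).numRealComponents = n := ⟨_, rfl⟩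
  obtain ⟨n', hn'⟩ : ∃ n' : ℕ, (W'.baseChange ℝ).numRealComponents = n' := ⟨_, rfl⟩
  have hn12 : n = 1 ∨ n = 2 := hn ▸ numRealComponents_eq_one_or_two _
  have hn'12 : n' = 1 ∨ n' = 2 := hn' ▸ numRealComponents_eq_one_or_two _
  have hn0 : (n : ℤ) ≠ 0 := by rcases hn12 with rfl | rfl <;> norm_num
  have hn'0 : (n' : ℤ) ≠ 0 := by rcases hn'12 with rfl | rfl <;> norm_num
  have hpn : ¬ (p : ℤ) ∣ n := by
    rcases hn12 with rfl | rfl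
    · exact_mod_cast hpP.not_dvd_one
    · intro h
      have : (p : ℤ) ∣ ((2 : ℕ) : ℤ) := by exact_mod_cast h
      have h2 : p ∣ 2 := by exact_mod_cast this
      exact hp2 ((Nat.prime_dvd_prime_iff_eq hpP Nat.prime_two).mp h2)
  refine ⟨((n * a : ℤ) : ℚ) / ((n' * α : ℤ) : ℚ), ?_, ?_, ?_⟩
  · exact div_ne_zero (by exact_mod_cast mul_ne_zero hn0 ha0) (by exact_mod_cast mul_ne_zero hn'0 hα0)
  · refine padicValRat_intCast_div_le_zero ?_ (mul_ne_zero hn'0 hα0)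
    intro h
    rcases hpZ.dvd_mul.mp h with h | h
    · exact hpn h
    · exact hpa h
  · rw [hΩ, hΩ', hn, hn']
    have hn'R : (n' : ℝ) ≠ 0 := by exact_mod_cast hn'0
    push_cast
    field_simp
    linear_combination (-(n : ℝ)) * ha

/-- **The sign-blind dichotomy (the sketch's P-2) is the disjunction of the two laws** — for the record: a
`p`-primitive scalar has cyclic `p`-kernel, on which conjugation is `±1`; here we only note the converse direction
used by the half-assemblies: either sign hypothesis alone already yields its disjunct. -/
theorem dichotomy_of_sign (W W' : WeierstrassCurve ℚ) [W.IsElliptic] [W.IsGloballyMinimal]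
    [W'.IsElliptic] [W'.IsGloballyMinimal] (L L' : PeriodPair) (p : ℕ) [Fact p.Prime] (α : ℤ)
    (hL : IsNeronLatticeOf (W.baseChange ℂ) L) (hL' : IsNeronLatticeOf (W'.baseChange ℂ) L') (hp2 : p ≠ 2)
    (hα0 : α ≠ 0) (hαL : ∀ z ∈ L.lattice, (α : ℂ) * z ∈ L'.lattice)
    (hsign : EvenKernelAt L L' p α ∨ OddKernelAt L L' p α) :
    (∃ q : ℚ, q ≠ 0 ∧ padicValRat p q ≤ 0 ∧ (q : ℝ) * W'.realPeriodRat = W.realPeriodRat) ∨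
      (∃ q : ℚ, q ≠ 0 ∧ padicValRat p q ≤ 0 ∧ (q : ℝ) * W'.imaginaryPeriodRat = W.imaginaryPeriodRat) := by
  rcases hsign with h | h
  · exact Or.inr (imaginaryRatio_of_evenKernelAt W W' L L' p α hL hL' hp2 hα0 hαL h)
  · exact Or.inl (realRatio_of_oddKernelAt W W' L L' p α hL hL' hp2 hα0 hαL h)

end ParityLaw

/-! ## §3  Row-level statements and the two half-assemblies (PROVED) -/

/-- Receptacle at the member — verbatim the sketch's `MemberReceptacle` (Kim–Nakamura Cor. 2.4 /
Kosters–Pannekoek): automatic for `p > 7`; at `p ∈ {5,7}` no globally minimal member has a `ℚ_p`-point of order `p`. -/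
def MemberReceptacle (W : WeierstrassCurve ℚ) [W.IsElliptic] (p : ℕ) [Fact p.Prime] : Prop :=
  7 < p ∨ ∀ (W' : WeierstrassCurve ℚ) [W'.IsElliptic] [W'.IsGloballyMinimal],
    WeierstrassCurve.IsIsogenous W W' →
      ∀ P : (W'.baseChange ℚ_[p]).toAffine.Point, p • P = 0 → P = 0

/-- The sketch's even non-resonance wall, verbatim (only the odd-sign half-assembly mentions it). -/
def EvenNonResonant (W : WeierstrassCurve ℚ) (p N : ℕ) : Prop :=
  ∀ ℓ ∈ N.primeFactors, ¬ ℓ ^ 2 ∣ N → (ℓ : ZMod p) ≠ (W.LFunction ℓ : ZMod p)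

/-- **EVEN KERNEL SIGN of the row `(W, Λ, p)`**: for every globally minimal member `W_K` of the isogeny class and
every `p`-PRIMITIVE integral scalar `αΛ ⊆ Λ(W_K)`, conjugation fixes the `p`-part of the kernel.  (Dictionary:
holds whenever `W[p]` is reducible non-split with EVEN stable line `φ₁`, i.e. `φ₁(−1) = 1`.) -/
def EvenKernelSign (W : WeierstrassCurve ℚ) [W.IsElliptic] (L : PeriodPair) (p : ℕ) : Prop :=
  ∀ (W_K : WeierstrassCurve ℚ) [W_K.IsElliptic] [W_K.IsGloballyMinimal] (L_K : PeriodPair) (α : ℤ),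
    WeierstrassCurve.IsIsogenous W W_K → IsNeronLatticeOf (W_K.baseChange ℂ) L_K →
    (∀ z ∈ L.lattice, (α : ℂ) * z ∈ L_K.lattice) → (∃ z ∈ L.lattice, ((α : ℂ) / p) * z ∉ L_K.lattice) →
    EvenKernelAt L L_K p α

/-- **ODD KERNEL SIGN of the row** (dictionary: `W[p]` reducible non-split with ODD stable line). -/
def OddKernelSign (W : WeierstrassCurve ℚ) [W.IsElliptic] (L : PeriodPair) (p : ℕ) : Prop :=
  ∀ (W_K : WeierstrassCurve ℚ) [W_K.IsElliptic] [W_K.IsGloballyMinimal] (L_K : PeriodPair) (α : ℤ),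
    WeierstrassCurve.IsIsogenous W W_K → IsNeronLatticeOf (W_K.baseChange ℂ) L_K →
    (∀ z ∈ L.lattice, (α : ℂ) * z ∈ L_K.lattice) → (∃ z ∈ L.lattice, ((α : ℂ) / p) * z ∉ L_K.lattice) →
    OddKernelAt L L_K p α

/-- **Kato member, ODD parity only** — the sketch's `KatoMemberTwoParity` with the even conjunct deleted: some
globally minimal member `W_K` has `p`-integral odd period scalar `Ω_f⁻/Ω⁻(W_K)`.  (From the sketch: P-1
`katoNeronMemberTwistedValues_of_sl2NeronValues hT₂ hP hDR hP1` + `oddMemberLever_holds`, i.e. the proof of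
`katoMemberTwoParity_of_leversT` with its last clause dropped — NO (E0-T), NO (E1), NO Mazur, NO wall.) -/
def KatoMemberOddParity : Prop :=
  ∀ (W : WeierstrassCurve ℚ) [W.IsElliptic] [W.IsGloballyMinimal] {N : ℕ} [NeZero N]
    (f : CuspForm (Gamma0 N) 2) (_ : IsNewformOf W f) (p : ℕ) [Fact p.Prime],
    5 ≤ p → p ^ 2 ∣ N → ¬ W.HasGoodReductionAtPrime p → ¬ W.HasMultiplicativeReductionAtPrime p →
    ¬ W.HasIrreducibleModPGaloisRep p → MemberReceptacle W p →
    ∃ (W_K : WeierstrassCurve ℚ) (_ : W_K.IsElliptic) (_ : W_K.IsGloballyMinimal),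
      WeierstrassCurve.IsIsogenous W W_K ∧
        (∀ ϖ : ℚ, (ϖ : ℝ) * W_K.imaginaryPeriodRat = minusPeriod f → 0 ≤ padicValRat p ϖ)

/-- **Kato member, EVEN parity only** (the sketch's even conjunct: behind the wall `EvenNonResonant`; from P-1 +
`evenMemberLeverT_holds` + (E0-T) + (E1)/Mazur). -/
def KatoMemberEvenParity : Prop :=
  ∀ (W : WeierstrassCurve ℚ) [W.IsElliptic] [W.IsGloballyMinimal] {N : ℕ} [NeZero N]
    (f : CuspForm (Gamma0 N) 2) (_ : IsNewformOf W f) (p : ℕ) [Fact p.Prime],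
    5 ≤ p → p ^ 2 ∣ N → ¬ W.HasGoodReductionAtPrime p → ¬ W.HasMultiplicativeReductionAtPrime p →
    ¬ W.HasIrreducibleModPGaloisRep p → MemberReceptacle W p →
    ∃ (W_K : WeierstrassCurve ℚ) (_ : W_K.IsElliptic) (_ : W_K.IsGloballyMinimal),
      WeierstrassCurve.IsIsogenous W W_K ∧
        (EvenNonResonant W p N →
          ∀ ϖ : ℚ, (ϖ : ℝ) * W_K.realPeriodRat = plusPeriod f → 0 ≤ padicValRat p ϖ)

/-- **R on the even-sign rows, WALL-FREE**: `p ∤ c(D)` for every additive `p ≥ 5`, `p² ∣ N`, `W[p]` reducible, at a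
lattice-optimal `X₀(N)`-datum, under the member receptacle and the EVEN KERNEL SIGN — no `EvenNonResonant`. -/
def ResidualEvenSign : Prop :=
  ∀ (W : WeierstrassCurve ℚ) [W.IsElliptic] [W.IsGloballyMinimal] {N : ℕ} [NeZero N]
    (D : ModularParametrizationData W N) (p : ℕ) [Fact p.Prime],
    5 ≤ p → p ^ 2 ∣ N → ¬ W.HasGoodReductionAtPrime p → ¬ W.HasMultiplicativeReductionAtPrime p →
    ¬ W.HasIrreducibleModPGaloisRep p →
    (∀ z ∈ D.L.lattice, ∃ w ∈ periodLattice D.f, z = D.c * w) →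
    MemberReceptacle W p → EvenKernelSign W D.L p → ¬ (p : ℤ) ∣ D.maninConstant

/-- **R on the odd-sign rows** (these are exactly the rows that consume the even lever and its wall). -/
def ResidualOddSign : Prop :=
  ∀ (W : WeierstrassCurve ℚ) [W.IsElliptic] [W.IsGloballyMinimal] {N : ℕ} [NeZero N]
    (D : ModularParametrizationData W N) (p : ℕ) [Fact p.Prime],
    5 ≤ p → p ^ 2 ∣ N → ¬ W.HasGoodReductionAtPrime p → ¬ W.HasMultiplicativeReductionAtPrime p →
    ¬ W.HasIrreducibleModPGaloisRep p →
    (∀ z ∈ D.L.lattice, ∃ w ∈ periodLattice D.f, z = D.c * w) →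
    MemberReceptacle W p → EvenNonResonant W p N → OddKernelSign W D.L p → ¬ (p : ℤ) ∣ D.maninConstant

section Assembly

/-- **A `p`-primitive INTEGRAL isogeny scalar** (verbatim the sketch's `exists_primitive_integral_scalar`): for
`ℚ`-isogenous globally minimal `W, W'` with Néron lattices `Λ, Λ'` there is `α ∈ ℤ` with `αΛ ⊆ Λ'`, `(α/p)Λ ⊄ Λ'`.
[cite: SilvermanATAEC1994, IV.5.1 with IV.6.1 and Cor. IV.9.1] [cite: SilvermanAEC2009, Thm. VI.4.1(b) and Thm. VI.5.3] -/
theorem exists_primitive_integral_scalar (W W' : WeierstrassCurve ℚ) [W.IsElliptic] [W.IsGloballyMinimal]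
    [W'.IsElliptic] [W'.IsGloballyMinimal] (L L' : PeriodPair) (p : ℕ) [Fact p.Prime]
    (hL : IsNeronLatticeOf (W.baseChange ℂ) L) (hL' : IsNeronLatticeOf (W'.baseChange ℂ) L')
    (hiso : IsIsogenous W W') :
    ∃ α : ℤ, (∀ z ∈ L.lattice, (α : ℂ) * z ∈ L'.lattice) ∧
      (∃ z ∈ L.lattice, ((α : ℂ) / p) * z ∉ L'.lattice) := by
  have hpP : p.Prime := Fact.out
  obtain ⟨a, ha0, haL⟩ := neronLattice_commensurable_of_isIsogenous_holds hiso hL hL'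
  let P : ℕ → Prop := fun j ↦ ∀ z ∈ L.lattice, (((a : ℚ) / (p : ℚ) ^ j : ℚ) : ℂ) * z ∈ L'.lattice
  have hP0 : P 0 := fun z hz ↦ by
    have e : (((a : ℚ) / (p : ℚ) ^ 0 : ℚ) : ℂ) = (a : ℂ) := by push_cast; ring
    rw [e]; exact haL z hz
  have hint : ∀ j, P j → ∃ k : ℤ, (k : ℚ) = (a : ℚ) / (p : ℚ) ^ j := fun j hj ↦
    integral_neronScaling_of_isGloballyMinimal_holds W W' L L' hL hL' _ hj
  have hbound : ∀ j, P j → j ≤ a.natAbs := by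
    intro j hj
    obtain ⟨k, hk⟩ := hint j hj
    have hpj : ((p : ℚ) ^ j) ≠ 0 := pow_ne_zero _ (by exact_mod_cast hpP.ne_zero)
    have hka : k * (p : ℤ) ^ j = a := by
      have h := hk
      field_simp at h
      exact_mod_cast h
    have hdvd : (p : ℤ) ^ j ∣ a := ⟨k, by rw [← hka]; ring⟩
    have hle : ((p : ℤ) ^ j).natAbs ≤ a.natAbs := Int.natAbs_le_of_dvd_ne_zero hdvd ha0
    rw [Int.natAbs_pow, Int.natAbs_natCast] at hle
    exact (Nat.lt_pow_self hpP.one_lt).le.trans hle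
  obtain ⟨j₀, hj₀⟩ : ∃ j₀, j₀ = Nat.findGreatest P a.natAbs := ⟨_, rfl⟩
  have hPj₀ : P j₀ := hj₀ ▸ Nat.findGreatest_spec (Nat.zero_le _) hP0
  have hnot : ¬ P (j₀ + 1) := fun h ↦
    Nat.findGreatest_is_greatest (hj₀ ▸ Nat.lt_succ_self j₀) (hbound _ h) h
  obtain ⟨α, hα⟩ := hint j₀ hPj₀
  refine ⟨α, fun z hz ↦ ?_, ?_⟩
  · have h := hPj₀ z hz
    rwa [← hα, Rat.cast_intCast] at h
  · by_contra hall
    push Not at hall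
    refine hnot fun z hz ↦ ?_
    have e : (((a : ℚ) / (p : ℚ) ^ (j₀ + 1) : ℚ) : ℂ) = (α : ℂ) / p := by
      rw [pow_succ, ← div_div, ← hα]
      push_cast
      ring
    rw [e]
    exact hall z hz

/-- The two valuation book-keeping facts about `c(D)` used by both half-assemblies: `p ∣ c ⇒ 1 ≤ v_p(c)` and
`v_p(|c|) = v_p(c)`. -/
theorem one_le_padicValRat_of_dvd {W : WeierstrassCurve ℚ} [W.IsElliptic] {N : ℕ} [NeZero N]
    (D : ModularParametrizationData W N) {p : ℕ} [Fact p.Prime] (hdiv : (p : ℤ) ∣ D.maninConstant) :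
    1 ≤ padicValRat p (D.c : ℚ) ∧ padicValRat p (|(D.c : ℚ)|) = padicValRat p (D.c : ℚ) ∧
      |(D.c : ℚ)| ≠ 0 := by
  have hc0 : D.c ≠ 0 := D.maninConstant_ne_zero_holds
  refine ⟨?_, ?_, abs_ne_zero.mpr (by exact_mod_cast hc0)⟩
  · rw [padicValRat.of_int]
    have h := (padicValInt_dvd_iff 1 D.c).mp (by rw [pow_one]; exact hdiv)
    rcases h with h | h
    · exact absurd h hc0
    · exact_mod_cast h
  · rcases abs_choice (D.c : ℚ) with h | h
    · rw [h]
    · rw [h, padicValRat.neg]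

/-- ★ **PAIR-LEVEL LAW I (even kernel ⇒ the odd scalar decides), PROVED — pure period book-keeping, `p` odd,
NO reduction-type / reducibility / level hypothesis.**  If a globally minimal member `W_K` has `p`-integral odd
scalar `ϖ⁻ = Ω_f⁻/Ω⁻(W_K)` and every `p`-primitive integral scalar `αΛ(W) ⊆ Λ(W_K)` has EVEN kernel sign, then
`p ∤ c(D)` at any lattice-optimal `X₀(N)`-datum `D` of `W`: `imaginaryRatio_of_evenKernelAt` gives
`Ω⁻(W) = q Ω⁻(W_K)`, `v_p(q) ≤ 0`; optimality gives `m Ω⁻(W) = |c| Ω_f⁻`, `m ∣ 2`; so `0 ≤ v_p(qm/|c|) ≤ −v_p(c)`. -/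
theorem not_dvd_maninConstant_of_oddScalar_of_evenKernel (W : WeierstrassCurve ℚ) [W.IsElliptic]
    [W.IsGloballyMinimal] {N : ℕ} [NeZero N] (D : ModularParametrizationData W N) (p : ℕ) [Fact p.Prime]
    (hp2 : p ≠ 2) (hopt : ∀ z ∈ D.L.lattice, ∃ w ∈ periodLattice D.f, z = D.c * w)
    (W_K : WeierstrassCurve ℚ) [W_K.IsElliptic] [W_K.IsGloballyMinimal] (hiso : IsIsogenous W W_K)
    (hodd : ∀ ϖ : ℚ, (ϖ : ℝ) * W_K.imaginaryPeriodRat = minusPeriod D.f → 0 ≤ padicValRat p ϖ)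
    (hsign : ∀ (L_K : PeriodPair) (α : ℤ), IsNeronLatticeOf (W_K.baseChange ℂ) L_K →
      (∀ z ∈ D.L.lattice, (α : ℂ) * z ∈ L_K.lattice) → (∃ z ∈ D.L.lattice, ((α : ℂ) / p) * z ∉ L_K.lattice) →
      EvenKernelAt D.L L_K p α) :
    ¬ (p : ℤ) ∣ D.maninConstant := by
  intro hdiv
  obtain ⟨hvc, hvabs, habsQ⟩ := one_le_padicValRat_of_dvd D hdiv
  haveI : (W_K.baseChange ℂ).IsElliptic := by rw [WeierstrassCurve.baseChange]; infer_instance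
  obtain ⟨L_K, hL_K⟩ := exists_isNeronLatticeOf_holds (W_K.baseChange ℂ)
  obtain ⟨α, hαL, hprim⟩ := exists_primitive_integral_scalar W W_K D.L L_K p D.isNeronLattice hL_K hiso
  have hα0 : α ≠ 0 := by
    rintro rfl
    obtain ⟨z, -, hz'⟩ := hprim
    apply hz'
    simp
  obtain ⟨q, hq0, hqv, hq⟩ := imaginaryRatio_of_evenKernelAt W W_K D.L L_K p α D.isNeronLattice hL_K hp2 hα0
    hαL (hsign L_K α hL_K hαL hprim)
  -- IMAGINARY parity: `m·Ω⁻(W) = |c|·Ω⁻_f`, `m ∣ 2`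
  obtain ⟨mm, hmm2, hmm⟩ := SkinnerUrban2014.exists_dvd_two_mul_imaginaryPeriodRat_eq_of_latticeEq D hopt
  have hmm0 : mm ≠ 0 := by
    rintro rfl
    exact two_ne_zero (Nat.eq_zero_of_zero_dvd hmm2)
  have hmmQ : (mm : ℚ) ≠ 0 := by exact_mod_cast hmm0
  have hvmm : padicValRat p (mm : ℚ) = 0 := by
    rw [padicValRat.of_nat]
    have hpP : p.Prime := Fact.out
    have : ¬ p ∣ mm := fun h ↦ by
      have h2 : p ∣ 2 := h.trans hmm2
      exact hp2 ((Nat.prime_dvd_prime_iff_eq hpP Nat.prime_two).mp h2)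
    exact_mod_cast padicValNat.eq_zero_of_not_dvd this
  have hϖ : ((q * mm / |(D.c : ℚ)| : ℚ) : ℝ) * W_K.imaginaryPeriodRat = minusPeriod D.f := by
    have habsR : |(D.c : ℝ)| ≠ 0 := abs_ne_zero.mpr (by exact_mod_cast D.maninConstant_ne_zero_holds)
    push_cast
    rw [div_mul_eq_mul_div, mul_right_comm, hq, mul_comm W.imaginaryPeriodRat, hmm]
    field_simp
  have hv := hodd _ hϖ
  rw [padicValRat.div (mul_ne_zero hq0 hmmQ) habsQ, padicValRat.mul hq0 hmmQ, hvmm, hvabs] at hv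
  linarith

/-- ★ **PAIR-LEVEL LAW II (odd kernel ⇒ the even scalar decides), PROVED.**  Symmetric, through
`realRatio_of_oddKernelAt` and `Ω⁺(W) = |c|·Ω_f⁺`.  (At pair level there is no wall either: the wall only enters
in how the sketch PRODUCES the even scalar's integrality.) -/
theorem not_dvd_maninConstant_of_evenScalar_of_oddKernel (W : WeierstrassCurve ℚ) [W.IsElliptic]
    [W.IsGloballyMinimal] {N : ℕ} [NeZero N] (D : ModularParametrizationData W N) (p : ℕ) [Fact p.Prime]
    (hp2 : p ≠ 2) (hopt : ∀ z ∈ D.L.lattice, ∃ w ∈ periodLattice D.f, z = D.c * w)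
    (W_K : WeierstrassCurve ℚ) [W_K.IsElliptic] [W_K.IsGloballyMinimal] (hiso : IsIsogenous W W_K)
    (heven : ∀ ϖ : ℚ, (ϖ : ℝ) * W_K.realPeriodRat = plusPeriod D.f → 0 ≤ padicValRat p ϖ)
    (hsign : ∀ (L_K : PeriodPair) (α : ℤ), IsNeronLatticeOf (W_K.baseChange ℂ) L_K →
      (∀ z ∈ D.L.lattice, (α : ℂ) * z ∈ L_K.lattice) → (∃ z ∈ D.L.lattice, ((α : ℂ) / p) * z ∉ L_K.lattice) →
      OddKernelAt D.L L_K p α) :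
    ¬ (p : ℤ) ∣ D.maninConstant := by
  intro hdiv
  obtain ⟨hvc, hvabs, habsQ⟩ := one_le_padicValRat_of_dvd D hdiv
  haveI : (W_K.baseChange ℂ).IsElliptic := by rw [WeierstrassCurve.baseChange]; infer_instance
  obtain ⟨L_K, hL_K⟩ := exists_isNeronLatticeOf_holds (W_K.baseChange ℂ)
  obtain ⟨α, hαL, hprim⟩ := exists_primitive_integral_scalar W W_K D.L L_K p D.isNeronLattice hL_K hiso
  have hα0 : α ≠ 0 := by
    rintro rfl
    obtain ⟨z, -, hz'⟩ := hprim
    apply hz'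
    simp
  obtain ⟨q, hq0, hqv, hq⟩ := realRatio_of_oddKernelAt W W_K D.L L_K p α D.isNeronLattice hL_K hp2 hα0
    hαL (hsign L_K α hL_K hαL hprim)
  -- REAL parity: `Ω(W) = |c|·Ω⁺_f` exactly
  have hΩ : W.realPeriodRat = |(D.c : ℝ)| * plusPeriod D.f :=
    D.realPeriodRat_eq_abs_mul_plusPeriod_of_latticeEq hopt
  have hϖ : ((q / |(D.c : ℚ)| : ℚ) : ℝ) * W_K.realPeriodRat = plusPeriod D.f := by
    have habsR : |(D.c : ℝ)| ≠ 0 := abs_ne_zero.mpr (by exact_mod_cast D.maninConstant_ne_zero_holds)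
    push_cast
    rw [div_mul_eq_mul_div, hq, hΩ]
    field_simp
  have hv := heven _ hϖ
  rw [padicValRat.div hq0 habsQ, hvabs] at hv
  linarith

/-- ★ **HALF-ASSEMBLY I (row level): even sign ⇒ the ODD lever ALONE gives R's conclusion — NO WALL.** -/
theorem residualEvenSign_of_katoMemberOddParity (hK : KatoMemberOddParity) : ResidualEvenSign := by
  intro W _ _ N _ D p _ hp5 hpN hgood hmult hred hopt hrec hsign
  obtain ⟨W_K, hKE, hKM, hiso, hodd⟩ := hK W D.f D.isNewformOf p hp5 hpN hgood hmult hred hrec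
  exact not_dvd_maninConstant_of_oddScalar_of_evenKernel W D p (by omega) hopt W_K hiso hodd
    (fun L_K α hL_K hαL hprim ↦ hsign W_K L_K α hiso hL_K hαL hprim)

/-- ★ **HALF-ASSEMBLY II (row level): odd sign ⇒ the EVEN lever (behind `EvenNonResonant`) gives R's
conclusion.** -/
theorem residualOddSign_of_katoMemberEvenParity (hK : KatoMemberEvenParity) : ResidualOddSign := by
  intro W _ _ N _ D p _ hp5 hpN hgood hmult hred hopt hrec hNR hsign
  obtain ⟨W_K, hKE, hKM, hiso, heven⟩ := hK W D.f D.isNewformOf p hp5 hpN hgood hmult hred hrec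
  exact not_dvd_maninConstant_of_evenScalar_of_oddKernel W D p (by omega) hopt W_K hiso (heven hNR)
    (fun L_K α hL_K hαL hprim ↦ hsign W_K L_K α hiso hL_K hαL hprim)

/-- **The bisection, recorded**: on a row carrying EITHER sign, R's conclusion follows from the matching single
parity of Kato's member (even sign: wall-free; odd sign: behind `EvenNonResonant`). -/
theorem residual_of_sign (hO : KatoMemberOddParity) (hE : KatoMemberEvenParity)
    (W : WeierstrassCurve ℚ) [W.IsElliptic] [W.IsGloballyMinimal] {N : ℕ} [NeZero N]
    (D : ModularParametrizationData W N) (p : ℕ) [Fact p.Prime] (hp5 : 5 ≤ p) (hpN : p ^ 2 ∣ N)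
    (hgood : ¬ W.HasGoodReductionAtPrime p) (hmult : ¬ W.HasMultiplicativeReductionAtPrime p)
    (hred : ¬ W.HasIrreducibleModPGaloisRep p)
    (hopt : ∀ z ∈ D.L.lattice, ∃ w ∈ periodLattice D.f, z = D.c * w) (hrec : MemberReceptacle W p)
    (hsign : EvenKernelSign W D.L p ∨ (EvenNonResonant W p N ∧ OddKernelSign W D.L p)) :
    ¬ (p : ℤ) ∣ D.maninConstant := by
  rcases hsign with h | ⟨hNR, h⟩
  · exact residualEvenSign_of_katoMemberOddParity hO W D p hp5 hpN hgood hmult hred hopt hrec h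
  · exact residualOddSign_of_katoMemberEvenParity hE W D p hp5 hpN hgood hmult hred hopt hrec hNR h

end Assembly

end Summit.BirchSwinnertonDyer.BirchSwinnertonDyer.Cruxes.ManinPrimeToAdditiveFiveLe.TwoParityKernelParity

end
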